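import Literature.MathematicalPhysics.KineticTheory.DiPernaLionsMildLimitProofs
import HarnessLib

/-!
# The exponential form of the DiPerna–Lions weak limit: supersolution and subsolution halves

Topic: MathematicalPhysics / KineticTheory. Infrastructure for the named fact (L12)
`diPernaLions_limit_expDuhamel` of
`Literature.MathematicalPhysics.KineticTheory.DiPernaLionsMildLimit` (Cercignani–Illner–Pulvirenti
1994 §5.3 Lemma 5.3.12, (3.37) = (3.44), p. 157: for all `t ∈ ℝ₊`,
`T_F⁻¹Q₊(f,f) ∈ L¹(ℝ^d × ℝ^d_loc)` and `f = f₀ e^{-F} + T_F⁻¹ Q₊(f,f)`, `F = T⁻¹(A ∗ f)`). The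
printed proof (pp. 158–159) establishes the two inequalities separately, by different mechanisms:

* `f ≥ f₀ e^{-F} + T_F⁻¹Q₊(f,f)` ((3.40), p. 158: the truncations `gₘⁿ = fⁿ ∧ m`, their weak
  limits `gₘ ↗ f`, the weak continuity (3.35) of `T_{Fₙ}⁻¹` and the monotone convergence theorem,
  which also give `T_F⁻¹Q₊(f,f) ∈ L¹((0,T) × ℝ^d × ℝ^d)`);
* `f ≤ f₀ e^{-F} + T_F⁻¹Q₊(f,f)` (display before (3.44), p. 159: the renormalisations
  `hₘⁿ = m ln (1 + fⁿ/m)`, (3.41)–(3.43), Lemma 5.3.11 iii) and `m → ∞`).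

This file records the two inequalities as *properties of a density* `f` for a kernel `B` — the
predicates `IsExpSupersolution B f`, `IsExpSubsolution B f` (for every `t ≥ 0`, almost everywhere
along characteristics, junk-free in `[0, ∞]`, with the true gain integral `eGain` inside the
damped gain primitive `eDampedGainPrimitive = (T_F⁻¹Q₊(f,f))♯ ∈ [0,∞]`) — and **proves** the end
of the argument ("this and (3.40) complete the assertion of the lemma: (3.44)", p. 159): a
DiPerna–Lions weak limit which is both an exponential super- and subsolution satisfies the two
conclusions (i)–(ii) of (L12) (`IsDiPernaLionsWeakLimit.expDuhamel_of_super_sub`), and hence (L12)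
follows once the two halves are established in the setting of `diPernaLions_extraction`
(`diPernaLions_limit_expDuhamel_of`, a conditional assembly with the two halves as hypotheses; no
named fact is introduced here). Everything in this file is proved.

The conversion to the Bochner-valued objects of (L12): finiteness of `eDampedGainPrimitive` (a
consequence of the supersolution inequality) forces `Q₊(f,f)♯(s) < ∞` for a.e. `s ∈ (0,t)`, where
`Kinetic.gainWith` takes its true value (`gainWith_eq_toReal_eGain`), so that
`dampedGainPrimitive = (eDampedGainPrimitive).toReal` (`dampedGainPrimitive_eq_toReal`); the local
integrability (i) of (L12) follows from the supersolution inequality by integrating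
`T_F⁻¹Q₊(f,f)(t) ≤ f(t)` over `E × B̄_R`, the invariance of Lebesgue measure under the
free-streaming shear (`measurePreserving_freeShear`) and the mass bound (3.32), through the
pointwise inequality `ofReal (gainWith) ≤ eGain` (`ofReal_gainWith_le_eGain`, junk values
included).

## Faithfulness notes

* CIP obtain (3.39)–(3.40) and the converse inequality as weak limits for every fixed `t`
  ((3.35) holds "for all `t ∈ [0,T]`", in `L¹(ℝ^d × ℝ^d_loc)`), i.e. as inequalities almost
  everywhere in `(x, ξ)` for each `t`; the predicates record them, like (L12), for every `t ≥ 0`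
  almost everywhere along characteristics `(x, v)`, with `f₀` the time-zero slice `f(0)` of the
  density (for the weak limit `= f₀` a.e., `IsDiPernaLionsWeakLimit.initial_ae`) and
  `F♯ = Kinetic.dampingExponent`, the Bochner primitive of `A ∗ f`, which is the true primitive
  along almost every characteristic of the weak limit by the proved collision-frequency bound (Lb)
  (`diPernaLions_limit_collisionFrequency_bound_holds`).
* The integrability clause "`T_F⁻¹Q₊(f,f) ∈ L¹((0,T) × ℝ^d × ℝ^d)`" of (3.40) is implied by the
  pointwise inequality (integrate `T_F⁻¹Q₊(f,f)(t) ≤ f(t)`, `f(t) ∈ L¹`) and is therefore derived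
  (in the local form (i) of (L12)) rather than made part of `IsExpSupersolution`.

## References

* C. Cercignani, R. Illner, M. Pulvirenti, *The Mathematical Theory of Dilute Gases*, Springer
  (1994), §5.3 Step 13 (`T⁻¹`, `T_F⁻¹`, (3.35)–(3.36), p. 157), Lemma 5.3.12 ((3.37), p. 157) and
  its proof ((3.38)–(3.40), p. 158; (3.41)–(3.44), pp. 158–159).
* R. J. DiPerna, P.-L. Lions, *On the Cauchy problem for Boltzmann equations: global existence and
  weak stability*, Ann. of Math. 130 (1989) 321–366.
-/

open MeasureTheory Metric Real Set Filter Topology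
open scoped InnerProductSpace ENNReal

noncomputable section

namespace Literature.MathematicalPhysics.KineticTheory

variable {E : Type*} [NormedAddCommGroup E] [InnerProductSpace ℝ E] [FiniteDimensional ℝ E]
  [MeasurableSpace E] [BorelSpace E]

/-! ## The true damped gain primitive -/

/-- The true (`[0,∞]`-valued) damped gain primitive along characteristics,
`(T_F⁻¹ Q₊(f,f))♯(t, x, v) = ∫₀ᵗ Q₊(f,f)♯(s, x, v) e^{-(F♯(t,x,v) - F♯(s,x,v))} ds ∈ [0, ∞]`
(CIP 1994 §5.3 Step 13, p. 157: `T_F⁻¹ = e^{-F} T⁻¹ e^{F}`,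
`T⁻¹g(x,ξ,t) = ∫₀ᵗ g(x - (t-s)ξ, ξ, s) ds`, read along the characteristic through `(x, v)`), with
the true gain integral `eGain` and `F♯ = Kinetic.dampingExponent`; the junk-free counterpart of
the Bochner-valued `Kinetic.dampedGainPrimitive` (`dampedGainPrimitive_eq_toReal`). [cite: CIPDiluteGases1994, §5.3 Step 13 (p. 157)] -/
def eDampedGainPrimitive (B : E × E → sphere (0 : E) 1 → ℝ) (f : ℝ → E → E → ℝ) (t : ℝ)
    (x v : E) : ℝ≥0∞ :=
  ∫⁻ s in Ioc 0 t, eGain B f (s, x + s • v, v) *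
    ENNReal.ofReal (exp (-(dampingExponent B f t x v - dampingExponent B f s x v)))

/-- Unfolding of `eDampedGainPrimitive`. [folklore] -/
theorem eDampedGainPrimitive_apply (B : E × E → sphere (0 : E) 1 → ℝ) (f : ℝ → E → E → ℝ)
    (t : ℝ) (x v : E) :
    eDampedGainPrimitive B f t x v = ∫⁻ s in Ioc 0 t, eGain B f (s, x + s • v, v) *
      ENNReal.ofReal (exp (-(dampingExponent B f t x v - dampingExponent B f s x v))) :=
  rfl

/-- At time `0` the true damped gain primitive vanishes. [folklore] -/
@[simp]
theorem eDampedGainPrimitive_zero (B : E × E → sphere (0 : E) 1 → ℝ) (f : ℝ → E → E → ℝ)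
    (x v : E) : eDampedGainPrimitive B f 0 x v = 0 := by
  simp [eDampedGainPrimitive]

/-! ## Exponential super- and subsolutions -/

/-- *`f` is a supersolution of the exponential form of the Boltzmann equation with kernel `B`*
(the inequality (3.40) of CIP 1994 §5.3, proof of Lemma 5.3.12, p. 158:
"`f ≥ f₀ e^{-F} + T_F⁻¹ Q₊(f,f)`", `F = T⁻¹(A ∗ f)`), recorded for every `t ≥ 0` almost everywhere
along characteristics `(x, v)`:
`f(0,x,v) e^{-F♯(t,x,v)} + ∫₀ᵗ Q₊(f,f)♯(s,x,v) e^{-(F♯(t,x,v) - F♯(s,x,v))} ds ≤ f♯(t,x,v)` in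
`[0, ∞]`, with the true gain integral (`eDampedGainPrimitive`) and `F♯ = Kinetic.dampingExponent`. [cite: CIPDiluteGases1994, §5.3 Lemma 5.3.12, proof, (3.40) (p. 158)] -/
def IsExpSupersolution (B : E × E → sphere (0 : E) 1 → ℝ) (f : ℝ → E → E → ℝ) : Prop :=
  ∀ t ≥ (0 : ℝ), ∀ᵐ z : E × E ∂(volume.prod volume),
    ENNReal.ofReal (f 0 z.1 z.2 * exp (-(dampingExponent B f t z.1 z.2))) +
      eDampedGainPrimitive B f t z.1 z.2 ≤ ENNReal.ofReal (alongFreeFlow f t z.1 z.2)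

/-- *`f` is a subsolution of the exponential form of the Boltzmann equation with kernel `B`*
(the converse inequality of CIP 1994 §5.3, proof of Lemma 5.3.12, display before (3.44), p. 159:
"As `m → ∞`, `f ≤ f₀ e^{-F} + T_F⁻¹ Q₊(f,f)`"), recorded for every `t ≥ 0` almost everywhere
along characteristics `(x, v)`:
`f♯(t,x,v) ≤ f(0,x,v) e^{-F♯(t,x,v)} + ∫₀ᵗ Q₊(f,f)♯(s,x,v) e^{-(F♯(t,x,v) - F♯(s,x,v))} ds` in
`[0, ∞]`, with the true gain integral (`eDampedGainPrimitive`) and `F♯ = Kinetic.dampingExponent`. [cite: CIPDiluteGases1994, §5.3 Lemma 5.3.12, proof, display before (3.44) (p. 159)] -/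
def IsExpSubsolution (B : E × E → sphere (0 : E) 1 → ℝ) (f : ℝ → E → E → ℝ) : Prop :=
  ∀ t ≥ (0 : ℝ), ∀ᵐ z : E × E ∂(volume.prod volume),
    ENNReal.ofReal (alongFreeFlow f t z.1 z.2) ≤
      ENNReal.ofReal (f 0 z.1 z.2 * exp (-(dampingExponent B f t z.1 z.2))) +
        eDampedGainPrimitive B f t z.1 z.2

/-- At `t = 0` the supersolution inequality holds trivially (`F♯(0) = 0`, empty time integral).
[folklore] -/
theorem expSupersolution_inequality_zero (B : E × E → sphere (0 : E) 1 → ℝ) (f : ℝ → E → E → ℝ)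
    (z : E × E) :
    ENNReal.ofReal (f 0 z.1 z.2 * exp (-(dampingExponent B f 0 z.1 z.2))) +
      eDampedGainPrimitive B f 0 z.1 z.2 ≤ ENNReal.ofReal (alongFreeFlow f 0 z.1 z.2) := by
  simp

/-! ## From the true to the Bochner-valued damped gain primitive -/

section Conversion

variable {B : E × E → sphere (0 : E) 1 → ℝ} {f : ℝ → E → E → ℝ}

/-- For any real function, `ofReal (∫ g) ≤ ∫⁻ ofReal g` (junk value `0` of the Bochner
integral included; for integrable `g`, `∫ g ≤ ∫ g⁺ = ∫⁻ ofReal g`). [folklore] -/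
theorem ofReal_integral_le_lintegral {α : Type*} [MeasurableSpace α] {μ : Measure α}
    (g : α → ℝ) : ENNReal.ofReal (∫ x, g x ∂μ) ≤ ∫⁻ x, ENNReal.ofReal (g x) ∂μ := by
  by_cases hg : Integrable g μ
  · calc ENNReal.ofReal (∫ x, g x ∂μ) ≤ ENNReal.ofReal (∫ x, max (g x) 0 ∂μ) :=
          ENNReal.ofReal_le_ofReal (integral_mono hg hg.pos_part fun x => le_max_left _ _)
      _ = ∫⁻ x, ENNReal.ofReal (max (g x) 0) ∂μ :=
          ofReal_integral_eq_lintegral_ofReal hg.pos_part (ae_of_all _ fun x => le_max_right _ _)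
      _ = ∫⁻ x, ENNReal.ofReal (g x) ∂μ := lintegral_congr fun x => by simp
  · rw [integral_undef hg, ENNReal.ofReal_zero]
    exact bot_le

/-- `ofReal (Q₊_Bochner) ≤ Q₊_true` pointwise: the iterated Bochner gain integral
`Kinetic.gainWith`, junk values included, never exceeds the true gain integral `eGain` (for each of
the two Bochner integrals, `ofReal ∫ ≤ ∫⁻ ofReal`; then Tonelli). [folklore] -/
theorem ofReal_gainWith_le_eGain (hBm : Measurable (Function.uncurry B))
    (hfm : Measurable fun z : ℝ × E × E => f z.1 z.2.1 z.2.2) (t : ℝ) (x v : E) :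
    ENNReal.ofReal (Literature.Analysis.FluidPDE.gainWith B (f t x) (f t x) v) ≤ eGain B f (t, x, v) := by
  haveI := Literature.Analysis.FluidPDE.isFiniteMeasure_sphereMeasure (E := E)
  have hGm : Measurable fun q : E × sphere (0 : E) 1 => B (v, q.1) q.2 *
      (f t x (KineticTheory.collide q.2 (v, q.1)).1 * f t x (KineticTheory.collide q.2 (v, q.1)).2) :=
    (measurable_gainIntegrand_param hBm hfm).comp (measurable_prodMk_left (x := ((t, x, v) : ℝ × E × E)))
  unfold Literature.Analysis.FluidPDE.gainWith eGain
  calc ENNReal.ofReal (∫ w, ∫ ω, B (v, w) ω *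
          (f t x (KineticTheory.collide ω (v, w)).1 * f t x (KineticTheory.collide ω (v, w)).2)
          ∂KineticTheory.sphereMeasure)
      ≤ ∫⁻ w, ENNReal.ofReal (∫ ω, B (v, w) ω *
          (f t x (KineticTheory.collide ω (v, w)).1 * f t x (KineticTheory.collide ω (v, w)).2)
          ∂KineticTheory.sphereMeasure) := ofReal_integral_le_lintegral _
    _ ≤ ∫⁻ w, ∫⁻ ω, ENNReal.ofReal (B (v, w) ω *
          (f t x (KineticTheory.collide ω (v, w)).1 * f t x (KineticTheory.collide ω (v, w)).2))
          ∂KineticTheory.sphereMeasure := lintegral_mono fun w => ofReal_integral_le_lintegral _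
    _ = ∫⁻ q : E × sphere (0 : E) 1, ENNReal.ofReal (B (v, q.1) q.2 *
          (f t x (KineticTheory.collide q.2 (v, q.1)).1 * f t x (KineticTheory.collide q.2 (v, q.1)).2))
          ∂(volume.prod KineticTheory.sphereMeasure) :=
        (lintegral_prod _ hGm.ennreal_ofReal.aemeasurable).symm

/-- Measurability of the true gain integral read along the characteristic through `(x, v)`.
[folklore] -/
theorem measurable_eGain_characteristic (hBm : Measurable (Function.uncurry B))
    (hfm : Measurable fun z : ℝ × E × E => f z.1 z.2.1 z.2.2) (x v : E) :
    Measurable fun s : ℝ => eGain B f (s, x + s • v, v) := by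
  have hγ : Continuous fun s : ℝ => ((s, x + s • v, v) : ℝ × E × E) := by fun_prop
  exact (measurable_eGain hBm hfm).comp hγ.measurable

/-- Measurability in `s` of the damping factor `e^{-(F♯(t) - F♯(s))}` (as an `[0,∞]`-valued
function). [folklore] -/
theorem measurable_ofReal_exp_dampingExponent (hBm : Measurable (Function.uncurry B))
    (hfm : Measurable fun z : ℝ × E × E => f z.1 z.2.1 z.2.2) (t : ℝ) (x v : E) :
    Measurable fun s : ℝ =>
      ENNReal.ofReal (exp (-(dampingExponent B f t x v - dampingExponent B f s x v))) := by
  have hγ : Measurable fun s : ℝ => ((s, x, v) : ℝ × E × E) := measurable_id.prodMk measurable_const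
  have h1 : Measurable fun s : ℝ => dampingExponent B f s x v :=
    (measurable_dampingExponent hBm hfm).comp hγ
  exact (measurable_const.sub h1).neg.exp.ennreal_ofReal

/-- **Where the true damped gain primitive is finite, the Bochner-valued one is its real part**:
finiteness of `∫₀ᵗ Q₊(f,f)♯(s) e^{-(F♯(t) - F♯(s))} ds` in `[0,∞]` forces `Q₊(f,f)♯(s) < ∞` for
a.e. `s ∈ (0, t)` (the damping factor is positive), where `Kinetic.gainWith` is the true gain
integral (`gainWith_eq_toReal_eGain`). [folklore] -/
theorem dampedGainPrimitive_eq_toReal (hBm : Measurable (Function.uncurry B))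
    (hB0 : ∀ p ω, 0 ≤ B p ω) (hfm : Measurable fun z : ℝ × E × E => f z.1 z.2.1 z.2.2)
    (hf0 : ∀ t ≥ (0 : ℝ), ∀ x v, 0 ≤ f t x v) {t : ℝ} {x v : E}
    (hfin : eDampedGainPrimitive B f t x v < ∞) :
    dampedGainPrimitive B f t x v = (eDampedGainPrimitive B f t x v).toReal := by
  unfold eDampedGainPrimitive at hfin ⊢
  set g : ℝ → ℝ≥0∞ := fun s => eGain B f (s, x + s • v, v) with hg
  set e : ℝ → ℝ := fun s => exp (-(dampingExponent B f t x v - dampingExponent B f s x v)) with he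
  have hgm : Measurable g := measurable_eGain_characteristic hBm hfm x v
  have hem : Measurable fun s => ENNReal.ofReal (e s) :=
    measurable_ofReal_exp_dampingExponent hBm hfm t x v
  have hprod : ∀ᵐ s ∂(volume.restrict (Ioc 0 t)), g s * ENNReal.ofReal (e s) < ∞ :=
    ae_lt_top (hgm.mul hem) hfin.ne
  have hgfin : ∀ᵐ s ∂(volume.restrict (Ioc 0 t)), g s < ∞ := by
    filter_upwards [hprod] with s hs
    have hes : ENNReal.ofReal (e s) ≠ 0 := (ENNReal.ofReal_pos.2 (exp_pos _)).ne'
    by_contra h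
    rw [not_lt, top_le_iff] at h
    rw [h, ENNReal.top_mul hes] at hs
    exact lt_irrefl _ hs
  have hae : ∀ᵐ s ∂(volume.restrict (Ioc 0 t)),
      alongFreeFlow (fun s y w => Literature.Analysis.FluidPDE.gainWith B (f s y) (f s y) w) s x v * e s =
        (g s * ENNReal.ofReal (e s)).toReal := by
    filter_upwards [hgfin, ae_restrict_mem measurableSet_Ioc] with s hs hsI
    have h1 : Literature.Analysis.FluidPDE.gainWith B (f s (x + s • v)) (f s (x + s • v)) v = (g s).toReal :=
      (gainWith_eq_toReal_eGain hBm hB0 hfm (s, x + s • v, v) (fun w => hf0 s hsI.1.le _ _) hs).2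
    rw [ENNReal.toReal_mul, ENNReal.toReal_ofReal (exp_pos _).le, alongFreeFlow_apply, h1]
  unfold dampedGainPrimitive
  rw [integral_congr_ae hae,
    integral_toReal (f := fun s => g s * ENNReal.ofReal (e s)) (hgm.mul hem).aemeasurable hprod]

end Conversion

/-! ## The end of the proof of Lemma 5.3.12: super- and subsolution give (L12) -/

section Assembly

variable {B : E × E → sphere (0 : E) 1 → ℝ} {f₀ : E → E → ℝ} {fseq : ℕ → ℝ → E → E → ℝ}
  {φ : ℕ → ℕ} {f : ℝ → E → E → ℝ}

/-- **Super- and subsolution give the exponential form** (CIP 1994 §5.3, end of the proof of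
Lemma 5.3.12, p. 159: "this and (3.40) complete the assertion of the lemma: (3.44)
`f = f₀ e^{-F} + T_F⁻¹ Q₊(f,f)`", together with "`T_F⁻¹Q₊(f,f) ∈ L¹`" from (3.40)). For a
DiPerna–Lions weak limit `f` (measurable, nonnegative, with the mass bound (3.32)) and a
DiPerna–Lions kernel `B`: if `f` is an exponential super- and subsolution, then (i) for every
`t ≥ 0` and `R`, the damped gain primitive `∫₀ᵗ Q₊(f,f)♯(s) e^{-(F♯(t)-F♯(s))} ds` (with the
Bochner gain term `Kinetic.gainWith`) has finite integral over `E × B̄_R` — from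
`T_F⁻¹Q₊(f,f)(t) ≤ f(t)`, the invariance of Lebesgue measure under the free-streaming shear and
the mass bound — and (ii) for every `t ≥ 0`, `f♯(t) = f(0) e^{-F♯(t)} + (T_F⁻¹Q₊(f,f))♯(t)` almost
everywhere (`Kinetic.dampedGainPrimitive`), the two inequalities in `[0,∞]` becoming a real
identity once the true damped gain primitive is known to be finite. [cite: CIPDiluteGases1994, §5.3 Lemma 5.3.12 (3.44) (p. 159)] -/
theorem IsDiPernaLionsWeakLimit.expDuhamel_of_super_sub (hW : IsDiPernaLionsWeakLimit f₀ fseq φ f)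
    (hB : IsDiPernaLionsKernel B) (hsup : IsExpSupersolution B f) (hsub : IsExpSubsolution B f) :
    (∀ t ≥ (0 : ℝ), ∀ R : ℝ, ∫⁻ z in univ ×ˢ closedBall (0 : E) R, (∫⁻ s in Ioc 0 t,
      ENNReal.ofReal (alongFreeFlow (fun s y w => Literature.Analysis.FluidPDE.gainWith B (f s y) (f s y) w) s z.1 z.2 *
        exp (-(dampingExponent B f t z.1 z.2 - dampingExponent B f s z.1 z.2))))
      ∂((volume : Measure E).prod volume) < ∞) ∧
    (∀ t ≥ (0 : ℝ), ∀ᵐ z : E × E ∂(volume.prod volume),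
      alongFreeFlow f t z.1 z.2 =
        f 0 z.1 z.2 * exp (-(dampingExponent B f t z.1 z.2)) + dampedGainPrimitive B f t z.1 z.2) := by
  have hBm := hB.measurable
  have hB0 := hB.nonneg
  have hfm := hW.measurable
  have hf0 := hW.nonneg
  refine ⟨fun t ht R => ?_, fun t ht => ?_⟩
  · -- (i) `T_F⁻¹Q₊(f,f)(t) ∈ L¹(E × B̄_R)`, from `T_F⁻¹Q₊(f,f)(t) ≤ f(t)` a.e.
    have hbox : ∀ᵐ z : E × E ∂(volume.prod volume), (∫⁻ s in Ioc 0 t,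
        ENNReal.ofReal (alongFreeFlow (fun s y w => Literature.Analysis.FluidPDE.gainWith B (f s y) (f s y) w) s z.1 z.2 *
          exp (-(dampingExponent B f t z.1 z.2 - dampingExponent B f s z.1 z.2)))) ≤
        ENNReal.ofReal (alongFreeFlow f t z.1 z.2) := by
      filter_upwards [hsup t ht] with z hz
      refine le_trans ?_ (le_trans le_add_self hz)
      rw [eDampedGainPrimitive_apply]
      refine lintegral_mono fun s => ?_
      rw [ENNReal.ofReal_mul' (exp_pos _).le]
      exact mul_le_mul_left (ofReal_gainWith_le_eGain hBm hfm s (z.1 + s • z.2) z.2) _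
    refine lt_of_le_of_lt (lintegral_mono_ae (ae_restrict_of_ae hbox)) ?_
    refine lt_of_le_of_lt (setLIntegral_le_lintegral _ _) ?_
    have key := (measurePreserving_freeShear (E := E) t).lintegral_comp
      (f := fun z : E × E => ENNReal.ofReal (f t z.1 z.2)) (hW.measurable_slice t).ennreal_ofReal
    rw [show (∫⁻ z : E × E, ENNReal.ofReal (alongFreeFlow f t z.1 z.2) ∂(volume.prod volume)) =
      ∫⁻ z : E × E, ENNReal.ofReal (f t z.1 z.2) ∂(volume.prod volume) from key]
    obtain ⟨C, hC⟩ := hW.massEntropy_le t ht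
    refine lt_of_le_of_lt (le_trans (lintegral_mono fun z => ?_) (hC t ⟨ht, le_rfl⟩))
      ENNReal.ofReal_lt_top
    refine ENNReal.ofReal_le_ofReal (le_mul_of_one_le_right (hf0 t ht _ _) ?_)
    nlinarith [sq_nonneg ‖z.1‖, sq_nonneg ‖z.2‖, abs_nonneg (log (f t z.1 z.2))]
  · -- (ii) the identity, from the two inequalities in `[0, ∞]`
    filter_upwards [hsup t ht, hsub t ht] with z hz1 hz2
    have heq : ENNReal.ofReal (alongFreeFlow f t z.1 z.2) =
        ENNReal.ofReal (f 0 z.1 z.2 * exp (-(dampingExponent B f t z.1 z.2))) +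
          eDampedGainPrimitive B f t z.1 z.2 := le_antisymm hz2 hz1
    have hfin : eDampedGainPrimitive B f t z.1 z.2 < ∞ :=
      lt_of_le_of_lt (le_trans le_add_self hz1) ENNReal.ofReal_lt_top
    have hD := dampedGainPrimitive_eq_toReal hBm hB0 hfm hf0 hfin
    have hDnn : 0 ≤ dampedGainPrimitive B f t z.1 z.2 := by
      rw [hD]; exact ENNReal.toReal_nonneg
    have ha : 0 ≤ f 0 z.1 z.2 * exp (-(dampingExponent B f t z.1 z.2)) :=
      mul_nonneg (hf0 0 le_rfl _ _) (exp_pos _).le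
    have hsharp : 0 ≤ alongFreeFlow f t z.1 z.2 := hf0 t ht _ _
    rw [show eDampedGainPrimitive B f t z.1 z.2 = ENNReal.ofReal (dampedGainPrimitive B f t z.1 z.2) by
      rw [hD, ENNReal.ofReal_toReal hfin.ne], ← ENNReal.ofReal_add ha hDnn] at heq
    exact (ENNReal.ofReal_eq_ofReal_iff hsharp (add_nonneg ha hDnn)).1 heq

end Assembly

/-! ## Conditional assembly of (L12) -/

universe u

/-- **Conditional assembly of (L12) `diPernaLions_limit_expDuhamel`** from its two printed halves
(CIP 1994 §5.3 Lemma 5.3.12: (3.40), p. 158, and the converse inequality, p. 159): if, in the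
setting of `diPernaLions_extraction`, every weak limit is an exponential supersolution
(`IsExpSupersolution`) and an exponential subsolution (`IsExpSubsolution`), then (L12) holds
(`IsDiPernaLionsWeakLimit.expDuhamel_of_super_sub`). The two hypotheses are the statements that
remain to be proved (CIP (3.35)–(3.36), (3.38)–(3.40), resp. (3.41)–(3.43), resting on the
velocity-averaging Lemmas 5.3.9–5.3.11); they are hypotheses of this theorem, not named facts. [cite: CIPDiluteGases1994, §5.3 Lemma 5.3.12 (pp. 157–159)] -/
theorem diPernaLions_limit_expDuhamel_of
    (hsup : ∀ {E : Type u} [NormedAddCommGroup E] [InnerProductSpace ℝ E] [FiniteDimensional ℝ E]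
      [MeasurableSpace E] [BorelSpace E] {B : E × E → sphere (0 : E) 1 → ℝ},
      IsDiPernaLionsKernel B → ∀ {f₀ : E → E → ℝ}, Literature.Analysis.FluidPDE.HasDiPernaLionsData f₀ →
      ∀ {δ : ℕ → ℝ} {Bseq : ℕ → E × E → sphere (0 : E) 1 → ℝ} {fseq : ℕ → ℝ → E → E → ℝ},
        (∀ n, 0 < δ n) → Antitone δ → Tendsto δ atTop (𝓝 0) →
        IsDiPernaLionsKernelApproximation B Bseq →
        IsDiPernaLionsDataApproximation f₀ (fun n => fseq n 0) →
        (∀ n, IsDiPernaLionsApproximateSolution (δ n) (Bseq n) (fseq n)) →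
        UniformDiPernaLionsBounds δ Bseq fseq →
        ∀ {φ : ℕ → ℕ} {f : ℝ → E → E → ℝ}, IsDiPernaLionsWeakLimit f₀ fseq φ f →
          IsExpSupersolution B f)
    (hsub : ∀ {E : Type u} [NormedAddCommGroup E] [InnerProductSpace ℝ E] [FiniteDimensional ℝ E]
      [MeasurableSpace E] [BorelSpace E] {B : E × E → sphere (0 : E) 1 → ℝ},
      IsDiPernaLionsKernel B → ∀ {f₀ : E → E → ℝ}, Literature.Analysis.FluidPDE.HasDiPernaLionsData f₀ →
      ∀ {δ : ℕ → ℝ} {Bseq : ℕ → E × E → sphere (0 : E) 1 → ℝ} {fseq : ℕ → ℝ → E → E → ℝ},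
        (∀ n, 0 < δ n) → Antitone δ → Tendsto δ atTop (𝓝 0) →
        IsDiPernaLionsKernelApproximation B Bseq →
        IsDiPernaLionsDataApproximation f₀ (fun n => fseq n 0) →
        (∀ n, IsDiPernaLionsApproximateSolution (δ n) (Bseq n) (fseq n)) →
        UniformDiPernaLionsBounds δ Bseq fseq →
        ∀ {φ : ℕ → ℕ} {f : ℝ → E → E → ℝ}, IsDiPernaLionsWeakLimit f₀ fseq φ f →
          IsExpSubsolution B f) :
    diPernaLions_limit_expDuhamel.{u} := by
  intro E _ _ _ _ _ B hB f₀ hf₀ δ Bseq fseq hδ hanti hlim hker hdata hsol hbd φ f hW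
  exact hW.expDuhamel_of_super_sub hB (hsup hB hf₀ hδ hanti hlim hker hdata hsol hbd hW)
    (hsub hB hf₀ hδ hanti hlim hker hdata hsol hbd hW)

end Literature.MathematicalPhysics.KineticTheory
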